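import Summits.RiemannHypothesis.RiemannHypothesis.Theorems.LiPrimeEchoResonantMain
import Summits.RiemannHypothesis.RiemannHypothesis.Theorems.LiEchoDirichletDefs
import HarnessLib

/-!
# RiemannHypothesis / LiDirichletEcho — crux K2χ `LiPrimeEdgeEchoChar`, part 2: the COMPLEX main term at the stationary
# point (RH-FREE, GRH-FREE)

RH-FREE · GRH-FREE [rh-li-eng g5, acting as prover on the unstaffed route].  Route `Theses/LiDirichletEcho.lean` (rung
«Li PRIME-ECHO LAW FOR DIRICHLET CHARACTERS» `LiTheory.LiZeroWindowEchoDirichlet`, L-P(P1χ)), item `LiPrimeEdgeEchoChar`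
(stmt-RiemannHypothesis-19393).  The twisted echo `liPrimeEchoTwist (χ 2) 2 n = Re[χ(2) · A₂ n^{1/4} e^{−i(2√(n log 2)+π/4)}]`
needs BOTH channels of ζ's resonant evaluation, whose tree form (`PrimeEdge.main_term_close`, route LiPrimeEcho) exports
only the real part.  Here: at the stationary point `s` (`n u(s) = log 2`, `s ≥ √n`, `n ≥ 400`) the stationary-phase main
term `g(s) conj(𝔣) e^{iP(s)} (n(−u₁(s)))^{−1/2}` equals the COMPLEX chirp `π A₂ n^{1/4} e^{−i(2√(n log 2) + π/4)}` up to
norm `≤ 400`.  Proof = the ζ proof verbatim (`X = g(s)√(2π)/√(n(−u₁(s)))`, `X₀ = π A₂ n^{1/4}`, `|X − X₀| ≤ 108π`;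
phase `θ = P(s) − π/4`, `θ₀ = 2√(n log 2) + π/4`, `X₀|θ + θ₀| ≤ 18π`) with the complex ending
`‖X e^{iθ} − X₀ e^{−iθ₀}‖ ≤ |X − X₀| + X₀‖e^{i(θ+θ₀)} − 1‖ ≤ 126π ≤ 400`.  Nothing here bears on the truth of RH or GRH.
-/

noncomputable section

-- D-0017: `Summit.<S>.<S>.…` is the designed namespace of a single-problem summit.
set_option linter.dupNamespace false

open Complex MeasureTheory intervalIntegral Set
open scoped Real Interval ArithmeticFunction.vonMangoldt
open Literature.Analysis.Fourier

namespace Summit.RiemannHypothesis.RiemannHypothesis.Theorems.LiTheory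

namespace CharPrimeEdge

open PrimeEdge

/-- The COMPLEX chirp of the prime 2: `π A₂ n^{1/4} e^{−i(2√(n log 2) + π/4)}` (its real part is `π · liPrimeEcho 2 n`,
and `Re[z · chirpTwo n] = π · liPrimeEchoTwist z 2 n`). -/
def chirpTwo (n : ℕ) : ℂ :=
  ((Real.pi * liEchoAmp * (n : ℝ) ^ (1 / 4 : ℝ) : ℝ) : ℂ) *
    Complex.exp (I * ((-(2 * Real.sqrt (n * Real.log 2) + Real.pi / 4) : ℝ) : ℂ))

/-- `E₂` twisted: `liPrimeEchoTwist z 2 n = A₂ n^{1/4} (Re z cos θ₀ + Im z sin θ₀)`, `θ₀ = 2√(n log 2) + π/4`. -/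
theorem liPrimeEchoTwist_two (z : ℂ) (n : ℕ) :
    liPrimeEchoTwist z 2 n = liEchoAmp * ((n : ℝ) ^ (1 / 4 : ℝ) *
      (z.re * Real.cos (2 * Real.sqrt (n * Real.log 2) + Real.pi / 4)
        + z.im * Real.sin (2 * Real.sqrt (n * Real.log 2) + Real.pi / 4))) := by
  -- as `liPrimeEcho_two` (Theorems/LiPrimeEchoDefs.lean)
  have h2 : 0 < Real.log 2 := Real.log_pos (by norm_num)
  have hΛ : (Λ 2 : ℝ) = Real.log 2 := by
    rw [ArithmeticFunction.vonMangoldt_apply_prime Nat.prime_two]; norm_num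
  have hpow : Real.log 2 * Real.log 2 ^ (-(3 / 4 : ℝ)) = Real.log 2 ^ (1 / 4 : ℝ) := by
    rw [show (1 / 4 : ℝ) = 1 + -(3 / 4 : ℝ) by norm_num, Real.rpow_add h2, Real.rpow_one]
  have hsqrt : Real.sqrt 2 * Real.sqrt Real.pi = Real.sqrt (2 * Real.pi) := by
    rw [Real.sqrt_mul (by norm_num : (0:ℝ) ≤ 2)]
  unfold liPrimeEchoTwist liEchoAmp
  rw [hΛ, ← hpow, ← hsqrt]
  push_cast
  ring

/-- `Re[z · chirpTwo n] = π · liPrimeEchoTwist z 2 n`. -/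
theorem re_mul_chirpTwo (z : ℂ) (n : ℕ) : (z * chirpTwo n).re = Real.pi * liPrimeEchoTwist z 2 n := by
  set θ₀ : ℝ := 2 * Real.sqrt (n * Real.log 2) + Real.pi / 4 with hθ₀
  have hexp : Complex.exp (I * ((-θ₀ : ℝ) : ℂ)) = (Real.cos θ₀ : ℂ) - (Real.sin θ₀ : ℂ) * I := by
    rw [mul_comm I, Complex.exp_mul_I]
    push_cast
    rw [Complex.cos_neg, Complex.sin_neg]
    ring
  rw [liPrimeEchoTwist_two, chirpTwo, ← hθ₀, hexp]
  simp only [Complex.mul_re, Complex.mul_im, Complex.sub_re, Complex.sub_im, Complex.ofReal_re, Complex.ofReal_im,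
    Complex.I_re, Complex.I_im]
  ring

/-- **The COMPLEX main term at the stationary point is `π A₂ n^{1/4} e^{−i(2√(n log 2)+π/4)} + O(1)`.**  For `n ≥ 400`,
`s ≥ √n` with `n u(s) = log 2`: `‖g(s) conj(𝔣) e^{iP(s)} (n(−u₁(s)))^{−1/2} − chirpTwo n‖ ≤ 400`. -/
theorem main_term_close_complex {n : ℕ} (hn : 400 ≤ n) {s : ℝ} (hs : Real.sqrt n ≤ s)
    (hstat : (n : ℝ) * ua s = Real.log 2) :
    ‖(gA n s : ℂ) * ((starRingEnd ℂ) fresnelC * Complex.exp (I * Ph n s) *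
        ((Real.sqrt (-(n * ub s)))⁻¹ : ℝ)) - chirpTwo n‖ ≤ 400 := by
  -- adapted from `PrimeEdge.main_term_close` (Theorems/LiPrimeEchoResonantMain.lean, route LiPrimeEcho): the
  -- amplitude and phase estimates are verbatim; only the final assembly is complex.
  have hn1 : 1 ≤ n := le_trans (by norm_num) hn
  obtain ⟨hr20, hr2⟩ := sqrt_facts hn
  obtain ⟨hs1, hsn, hs3⟩ := window_facts hn1 hs
  have hn' : (400 : ℝ) ≤ n := by exact_mod_cast hn
  have hn0 : (0 : ℝ) < n := by linarith only [hn']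
  have hs20 : 20 ≤ s := hr20.trans hs
  have hs0 : 0 < s := by linarith only [hs20]
  obtain ⟨ht1, ht2⟩ := stationary_sq_bounds hn1 hs hstat
  have hL := Real.log_two_lt_d9
  have hL' := Real.log_two_gt_d9
  set L : ℝ := Real.log 2 with hLdef
  have hL0 : 0 < L := by linarith only [hL']
  have hexpL : Real.exp L = 2 := by rw [hLdef, Real.exp_log (by norm_num)]
  have hπ := Real.pi_pos
  have hπ3 := Real.pi_gt_three
  have hπ4 := Real.pi_lt_four
  -- `ν = 1/n`
  set ν : ℝ := 1 / (n : ℝ) with hν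
  have hν0 : 0 < ν := by positivity
  have hν400 : ν ≤ 1 / 400 := by rw [hν]; exact div_le_div_of_nonneg_left (by norm_num) (by norm_num) hn'
  have hnν : (n : ℝ) * ν = 1 := by rw [hν]; field_simp
  have hdivν : ∀ k : ℝ, k / n = k * ν := fun k ↦ by rw [hν]; ring
  -- ### amplitude: `E = e^{n h(s)} = 2 e^{η}`, `|η| ≤ 7ν`
  set η : ℝ := n * ha s - L with hη
  have hη7 : |η| ≤ 7 * ν := by
    have h := abs_ha_sub_ua_le hs1
    have e : η = n * (ha s - ua s) := by rw [hη, ← hstat]; ring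
    rw [e, abs_mul, abs_of_nonneg hn0.le, ← hdivν]
    have hs4 : (n : ℝ) ^ 2 ≤ s ^ 4 := by
      calc (n : ℝ) ^ 2 ≤ (s ^ 2) ^ 2 := pow_le_pow_left₀ hn0.le hsn 2
        _ = s ^ 4 := by ring
    calc (n : ℝ) * |ha s - ua s| ≤ n * (7 / s ^ 4) := by gcongr
      _ ≤ n * (7 / (n : ℝ) ^ 2) := by gcongr
      _ = 7 / n := by field_simp
  set E : ℝ := Real.exp (n * ha s) with hE
  have hE2 : E / 2 = Real.exp η := by rw [hE, hη, Real.exp_sub, hexpL]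
  have he4 : |(E / 2) ^ 4 - 1| ≤ 56 * ν := by
    rw [hE2, ← Real.exp_nat_mul]
    have h4η : |((4 : ℕ) : ℝ) * η| ≤ 28 * ν := by
      push_cast; rw [abs_mul, abs_of_pos (by norm_num : (0:ℝ) < 4)]; linarith only [hη7]
    have h1 : |((4 : ℕ) : ℝ) * η| ≤ 1 := h4η.trans (by linarith only [hν400])
    calc |Real.exp (((4 : ℕ) : ℝ) * η) - 1| ≤ 2 * |((4 : ℕ) : ℝ) * η| := Real.abs_exp_sub_one_le h1
      _ ≤ 2 * (28 * ν) := by gcongr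
      _ = 56 * ν := by ring
  -- ### curvature: `V = n(−u₁(s))`, `ψ = s³(−u₁(s)) ∈ [2 − 30ν, 2 + 30ν]`
  set V : ℝ := n * (-ub s) with hV
  have hub_lo := le_neg_ub (by linarith : (3 : ℝ) ≤ s)
  have hV0 : 0 < V := by rw [hV]; exact mul_pos hn0 (lt_of_lt_of_le (by positivity) hub_lo)
  set ψ : ℝ := s ^ 3 * (-ub s) with hψ
  have hψb : |ψ - 2| ≤ 30 * ν := by
    rw [← hdivν]
    exact (abs_cube_mul_neg_ub_sub_two_le hs1).trans (div_le_div_of_nonneg_left (by norm_num) hn0 hsn)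
  obtain ⟨hψ1, hψ2⟩ := abs_le.1 hψb
  -- `ρ = n/(L s²) ∈ [1, 1 + 5ν]`
  set ρ : ℝ := n / (L * s ^ 2) with hρ
  have hρ1 : 1 ≤ ρ := by rw [hρ, le_div_iff₀ (by positivity)]; linarith only [ht1, hLdef]
  have hρ2 : ρ ≤ 1 + 5 * ν := by
    rw [hρ, div_le_iff₀ (by positivity)]
    -- `n ≤ (1 + 5ν) L s²` ⟸ `L s² ≥ n − 4` and `5ν(n − 4) = 5 − 20ν ≥ 4`
    have h1 : (1 + 5 * ν) * ((n : ℝ) - 4) ≤ (1 + 5 * ν) * (L * s ^ 2) :=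
      mul_le_mul_of_nonneg_left (by linarith only [ht2, hLdef]) (by positivity)
    have e : (1 + 5 * ν) * ((n : ℝ) - 4) = n + 5 * (n * ν) - 4 - 20 * ν := by ring
    rw [e, hnν] at h1
    linarith only [h1, hν400]
  -- `W = V² n/(4L³) = (ψ/2)² ρ³ ∈ [1 − 30ν, 1 + 52ν]`
  set W : ℝ := V ^ 2 * n / (4 * L ^ 3) with hW
  have hWeq : W = (ψ / 2) ^ 2 * ρ ^ 3 := by
    rw [hW, hV, hψ, hρ]
    field_simp
    ring
  have hψ0 : 0 ≤ ψ / 2 := by linarith only [hψ1, hν400]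
  obtain ⟨hpoly1, hpoly2⟩ := poly_bounds hν0 hν400
  have hW1 : 1 - 30 * ν ≤ W := by
    rw [hWeq]
    have h1 : 1 - 15 * ν ≤ ψ / 2 := by linarith only [hψ1]
    have h15 : 0 ≤ 1 - 15 * ν := by linarith only [hν400]
    have h2 : (1 - 15 * ν) ^ 2 ≤ (ψ / 2) ^ 2 := pow_le_pow_left₀ h15 h1 2
    have h4 : (ψ / 2) ^ 2 ≤ (ψ / 2) ^ 2 * ρ ^ 3 := le_mul_of_one_le_right (sq_nonneg _) (one_le_pow₀ hρ1)
    linarith only [hpoly2, h2, h4]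
  have hW2 : W ≤ 1 + 52 * ν := by
    rw [hWeq]
    have h1 : ψ / 2 ≤ 1 + 15 * ν := by linarith only [hψ2]
    have h2 : (ψ / 2) ^ 2 ≤ (1 + 15 * ν) ^ 2 := pow_le_pow_left₀ hψ0 h1 2
    have h3 : ρ ^ 3 ≤ (1 + 5 * ν) ^ 3 := pow_le_pow_left₀ (by linarith only [hρ1]) hρ2 3
    calc (ψ / 2) ^ 2 * ρ ^ 3 ≤ (1 + 15 * ν) ^ 2 * (1 + 5 * ν) ^ 3 := mul_le_mul h2 h3 (by positivity) (by positivity)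
      _ ≤ 1 + 52 * ν := hpoly1
  have hW0 : 0 < W := by linarith only [hW1, hν400]
  -- ### the fourth powers of `X = g √(2π)/√V` and `X₀ = π A₂ n^{1/4}`
  set n4 : ℝ := (n : ℝ) ^ (1 / 4 : ℝ) with hn4
  have hn4_0 : 0 < n4 := Real.rpow_pos_of_pos hn0 _
  have hn4_4 : n4 ^ 4 = n := by
    rw [hn4, ← Real.rpow_natCast, ← Real.rpow_mul hn0.le]; norm_num
  have hn4_2 : n4 ^ 2 = Real.sqrt n := by
    rw [hn4, ← Real.rpow_natCast, ← Real.rpow_mul hn0.le, Real.sqrt_eq_rpow]; norm_num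
  have hn4_1 : 1 ≤ n4 := Real.one_le_rpow (by linarith) (by norm_num)
  have hn4_n : n4 ≤ n := by
    calc n4 ≤ n4 ^ 4 := le_self_pow₀ hn4_1 (by norm_num)
      _ = n := hn4_4
  have hn4_s : n4 ≤ s := by
    calc n4 ≤ n4 ^ 2 := le_self_pow₀ hn4_1 (by norm_num)
      _ = Real.sqrt n := hn4_2
      _ ≤ s := hs
  set l4 : ℝ := L ^ (1 / 4 : ℝ) with hl4
  have hl4_0 : 0 < l4 := Real.rpow_pos_of_pos hL0 _
  have hl4_4 : l4 ^ 4 = L := by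
    rw [hl4, ← Real.rpow_natCast, ← Real.rpow_mul hL0.le]; norm_num
  have hl4_1 : l4 ≤ 1 := Real.rpow_le_one hL0.le (by linarith) (by norm_num)
  have hkap4 : kap ^ 4 = L ^ 4 / 64 := by rw [kap_pow_four, ← hLdef]
  have h2π : 0 < Real.sqrt (2 * Real.pi) := Real.sqrt_pos.2 (by positivity)
  have h2π2 : Real.sqrt (2 * Real.pi) ^ 2 = 2 * Real.pi := Real.sq_sqrt (by positivity)
  have h2π1 : 1 ≤ Real.sqrt (2 * Real.pi) := by
    rw [← Real.sqrt_one]; exact Real.sqrt_le_sqrt (by linarith)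
  have hsV : 0 < Real.sqrt V := Real.sqrt_pos.2 hV0
  have hsV2 : Real.sqrt V ^ 2 = V := Real.sq_sqrt hV0.le
  set X : ℝ := gA n s * Real.sqrt (2 * Real.pi) * (Real.sqrt V)⁻¹ with hX
  set X₀ : ℝ := Real.pi * liEchoAmp * n4 with hX₀
  have hX₀eq : X₀ = Real.pi * l4 * n4 / Real.sqrt (2 * Real.pi) := by
    rw [hX₀, liEchoAmp, ← hLdef, ← hl4]; ring
  have hX0 : 0 < X := by rw [hX]; exact mul_pos (mul_pos (gA_pos n s) h2π) (inv_pos.2 hsV)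
  have hX₀0 : 0 < X₀ := by rw [hX₀eq]; positivity
  have hgA : gA n s = kap * E := rfl
  -- `X⁴ = X₀⁴ · (E/2)⁴/W`
  have hX4 : X ^ 4 = X₀ ^ 4 * ((E / 2) ^ 4 / W) := by
    have e1 : X ^ 4 = kap ^ 4 * E ^ 4 * (Real.sqrt (2 * Real.pi) ^ 2) ^ 2 / (Real.sqrt V ^ 2) ^ 2 := by
      rw [hX, hgA]; field_simp
    have e2 : X₀ ^ 4 = Real.pi ^ 4 * l4 ^ 4 * n4 ^ 4 / (Real.sqrt (2 * Real.pi) ^ 2) ^ 2 := by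
      rw [hX₀eq]; field_simp
    rw [e1, e2, hkap4, h2π2, hsV2, hl4_4, hn4_4, hW]
    field_simp
    ring
  -- `(E/2)⁴/W ∈ [1 − 108ν, 1 + 100ν]`
  obtain ⟨hR1, hR2⟩ := ratio_bounds hν0 hν400 he4 hW1 hW2
  -- `X ∈ [X₀(1 − 108ν), X₀(1 + 100ν)]`
  have hX₀4 : 0 ≤ X₀ ^ 4 := by positivity
  have hXup : X ≤ X₀ * (1 + 100 * ν) := by
    have h1 : X ^ 4 ≤ (X₀ * (1 + 100 * ν)) ^ 4 := by
      calc X ^ 4 = X₀ ^ 4 * ((E / 2) ^ 4 / W) := hX4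
        _ ≤ X₀ ^ 4 * (1 + 100 * ν) := mul_le_mul_of_nonneg_left hR2 hX₀4
        _ ≤ X₀ ^ 4 * (1 + 100 * ν) ^ 4 :=
            mul_le_mul_of_nonneg_left (le_self_pow₀ (by linarith only [hν0]) (by norm_num)) hX₀4
        _ = (X₀ * (1 + 100 * ν)) ^ 4 := by ring
    exact (pow_le_pow_iff_left₀ hX0.le (by positivity) (by norm_num)).1 h1
  have hXlo : X₀ * (1 - 108 * ν) ≤ X := by
    have h0 : 0 ≤ 1 - 108 * ν := by linarith only [hν400]
    have h1 : (X₀ * (1 - 108 * ν)) ^ 4 ≤ X ^ 4 := by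
      calc (X₀ * (1 - 108 * ν)) ^ 4 = X₀ ^ 4 * (1 - 108 * ν) ^ 4 := by ring
        _ ≤ X₀ ^ 4 * (1 - 108 * ν) :=
            mul_le_mul_of_nonneg_left (pow_le_of_le_one h0 (by linarith only [hν0]) (by norm_num)) hX₀4
        _ ≤ X₀ ^ 4 * ((E / 2) ^ 4 / W) := mul_le_mul_of_nonneg_left hR1 hX₀4
        _ = X ^ 4 := hX4.symm
    exact (pow_le_pow_iff_left₀ (by positivity) hX0.le (by norm_num)).1 h1
  have hX₀ν : X₀ * ν ≤ Real.pi := by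
    rw [hX₀eq, hν]
    have : l4 * n4 ≤ 1 * n := mul_le_mul hl4_1 hn4_n hn4_0.le (by norm_num)
    have e : Real.pi * l4 * n4 / Real.sqrt (2 * Real.pi) * (1 / n) = Real.pi * (l4 * n4) / (Real.sqrt (2 * Real.pi) * n) := by
      field_simp
    rw [e, div_le_iff₀ (by positivity)]
    calc Real.pi * (l4 * n4) ≤ Real.pi * (1 * n) := by gcongr
      _ ≤ Real.pi * (Real.sqrt (2 * Real.pi) * n) :=
          mul_le_mul_of_nonneg_left (mul_le_mul_of_nonneg_right h2π1 hn0.le) hπ.le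
  have hXX : |X - X₀| ≤ 108 * Real.pi := by
    have e1 : X₀ * (1 + 100 * ν) = X₀ + 100 * (X₀ * ν) := by ring
    have e2 : X₀ * (1 - 108 * ν) = X₀ - 108 * (X₀ * ν) := by ring
    have hpos : 0 ≤ X₀ * ν := by positivity
    rw [abs_le]; constructor <;> linarith only [hXup, hXlo, e1, e2, hX₀ν, hpos, hπ]
  -- ### the phase: `θ = P(s) − π/4`, `θ₀ = 2σ + π/4`, `|θ + θ₀| ≤ 16ν + 2n/s³`
  set σ : ℝ := Real.sqrt (n * L) with hσ
  have hσ0 : 0 ≤ σ := Real.sqrt_nonneg _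
  have hσ2 : (2 * σ) ^ 2 = 4 * (n * L) := by rw [mul_pow, Real.sq_sqrt (by positivity)]; ring
  set f : ℝ := L * s + n / s - 2 * σ with hf
  have hab0 : 0 < L * s + n / s := by positivity
  have hf0 : 0 ≤ f := by
    have h1 : (2 * σ) ^ 2 ≤ (L * s + n / s) ^ 2 := by
      rw [hσ2]
      have : (L * s + n / s) ^ 2 - 4 * (n * L) = (L * s - n / s) ^ 2 := by field_simp; ring
      linarith only [this, sq_nonneg (L * s - n / s)]
    have := (pow_le_pow_iff_left₀ (by positivity) hab0.le two_ne_zero).1 h1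
    rw [hf]; linarith only [this]
  have hf1 : f ≤ 16 * ν := by
    have hprod : f * (L * s + n / s + 2 * σ) = (L * s - n / s) ^ 2 := by
      have : f * (L * s + n / s + 2 * σ) = (L * s + n / s) ^ 2 - (2 * σ) ^ 2 := by rw [hf]; ring
      rw [this, hσ2]; field_simp; ring
    have hsq : (L * s - n / s) ^ 2 ≤ 16 * ν := by
      have e : (L * s - n / s) ^ 2 = (s ^ 2 * L - n) ^ 2 / s ^ 2 := by field_simp
      rw [e, hν, mul_one_div, div_le_div_iff₀ (by positivity) hn0]
      have h16 : (s ^ 2 * L - n) ^ 2 ≤ 16 := by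
        have hlo : -4 ≤ s ^ 2 * L - n := by linarith only [ht2]
        have hhi : s ^ 2 * L - n ≤ 0 := by linarith only [ht1]
        nlinarith only [hlo, hhi]
      nlinarith only [h16, hsn, hn0, sq_nonneg (s ^ 2 * L - n)]
    have hbig : 1 ≤ L * s + n / s + 2 * σ := by
      have h1 : 1 ≤ (n : ℝ) / s := by
        rw [le_div_iff₀ hs0]
        have : s ^ 2 ≤ 2 * n := by nlinarith only [ht1, hL', mul_nonneg (sq_nonneg s) (sub_nonneg.2 hL'.le)]
        nlinarith only [this, hs20]
      have : 0 ≤ L * s := by positivity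
      linarith
    calc f = f * 1 := by ring
      _ ≤ f * (L * s + n / s + 2 * σ) := mul_le_mul_of_nonneg_left hbig hf0
      _ = (L * s - n / s) ^ 2 := hprod
      _ ≤ 16 * ν := hsq
  have hbq : |(n : ℝ) * (bq s - 1 / s)| ≤ 2 * n / s ^ 3 := by
    rw [abs_mul, abs_of_nonneg hn0.le]
    calc (n : ℝ) * |bq s - 1 / s| ≤ n * (2 / s ^ 3) := mul_le_mul_of_nonneg_left (abs_bq_sub_inv_le hs0) hn0.le
      _ = 2 * n / s ^ 3 := by ring
  set θ : ℝ := Ph n s - Real.pi / 4 with hθ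
  set θ₀ : ℝ := 2 * σ + Real.pi / 4 with hθ₀
  have hθθ : |θ + θ₀| ≤ 16 * ν + 2 * n / s ^ 3 := by
    have e : θ + θ₀ = -f - n * (bq s - 1 / s) := by
      rw [hθ, hθ₀, hf, Ph, ← hLdef]; field_simp; ring
    rw [e]
    calc |-f - n * (bq s - 1 / s)| ≤ |-f| + |(n : ℝ) * (bq s - 1 / s)| := abs_sub _ _
      _ ≤ 16 * ν + 2 * n / s ^ 3 := by rw [abs_neg, abs_of_nonneg hf0]; exact add_le_add hf1 hbq
  have hX₀θ : X₀ * |θ + θ₀| ≤ 18 * Real.pi := by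
    have h1 : X₀ * (16 * ν) ≤ 16 * Real.pi := by linarith only [hX₀ν]
    have h2 : X₀ * (2 * n / s ^ 3) ≤ 2 * Real.pi := by
      rw [hX₀eq]
      have hns : n4 * n ≤ s ^ 3 := by
        calc n4 * n ≤ s * s ^ 2 := mul_le_mul hn4_s hsn hn0.le hs0.le
          _ = s ^ 3 := by ring
      have e : Real.pi * l4 * n4 / Real.sqrt (2 * Real.pi) * (2 * n / s ^ 3)
          = 2 * Real.pi * (l4 * ((n4 * n) / s ^ 3)) / Real.sqrt (2 * Real.pi) := by
        field_simp
      rw [e, div_le_iff₀ h2π]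
      have hq : n4 * n / s ^ 3 ≤ 1 := by rw [div_le_one (by positivity)]; exact hns
      have : l4 * (n4 * n / s ^ 3) ≤ 1 := by
        calc l4 * (n4 * n / s ^ 3) ≤ 1 * 1 := mul_le_mul hl4_1 hq (by positivity) (by norm_num)
          _ = 1 := by ring
      nlinarith only [this, hπ, h2π1]
    calc X₀ * |θ + θ₀| ≤ X₀ * (16 * ν + 2 * n / s ^ 3) := mul_le_mul_of_nonneg_left hθθ hX₀0.le
      _ = X₀ * (16 * ν) + X₀ * (2 * n / s ^ 3) := by ring
      _ ≤ 16 * Real.pi + 2 * Real.pi := add_le_add h1 h2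
      _ = 18 * Real.pi := by ring
  -- ### assembly (complex)
  have hM : (gA n s : ℂ) * ((starRingEnd ℂ) fresnelC * Complex.exp (I * Ph n s) *
      ((Real.sqrt (-(n * ub s)))⁻¹ : ℝ)) = (X : ℂ) * Complex.exp (I * (θ : ℂ)) := by
    have hV' : -((n : ℝ) * ub s) = V := by rw [hV]; ring
    rw [conj_fresnelC_mul_exp, hV', ← hθ, hX]
    push_cast
    ring
  have hT : chirpTwo n = (X₀ : ℂ) * Complex.exp (I * ((-θ₀ : ℝ) : ℂ)) := by
    rw [chirpTwo, hX₀, hθ₀, hσ, hn4, hLdef]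
  rw [hM, hT]
  -- `X e^{iθ} − X₀ e^{−iθ₀} = (X − X₀) e^{iθ} + X₀ e^{−iθ₀} (e^{i(θ+θ₀)} − 1)`
  have hsplit : (X : ℂ) * Complex.exp (I * (θ : ℂ)) - (X₀ : ℂ) * Complex.exp (I * ((-θ₀ : ℝ) : ℂ))
      = ((X - X₀ : ℝ) : ℂ) * Complex.exp (I * (θ : ℂ))
        + (X₀ : ℂ) * Complex.exp (I * ((-θ₀ : ℝ) : ℂ)) * (Complex.exp (I * ((θ + θ₀ : ℝ) : ℂ)) - 1) := by
    have e : Complex.exp (I * ((-θ₀ : ℝ) : ℂ)) * Complex.exp (I * ((θ + θ₀ : ℝ) : ℂ)) = Complex.exp (I * (θ : ℂ)) := by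
      rw [← Complex.exp_add]; push_cast; ring_nf
    rw [mul_sub, mul_assoc, e]
    push_cast
    ring
  have hn1 : ‖Complex.exp (I * (θ : ℂ))‖ = 1 := Complex.norm_exp_I_mul_ofReal θ
  have hn2 : ‖Complex.exp (I * ((-θ₀ : ℝ) : ℂ))‖ = 1 := Complex.norm_exp_I_mul_ofReal (-θ₀)
  have hn3 : ‖Complex.exp (I * ((θ + θ₀ : ℝ) : ℂ)) - 1‖ ≤ |θ + θ₀| := by
    have := Real.norm_exp_I_mul_ofReal_sub_one_le (x := θ + θ₀)
    rwa [Real.norm_eq_abs] at this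
  rw [hsplit]
  calc ‖((X - X₀ : ℝ) : ℂ) * Complex.exp (I * (θ : ℂ))
        + (X₀ : ℂ) * Complex.exp (I * ((-θ₀ : ℝ) : ℂ)) * (Complex.exp (I * ((θ + θ₀ : ℝ) : ℂ)) - 1)‖
      ≤ ‖((X - X₀ : ℝ) : ℂ) * Complex.exp (I * (θ : ℂ))‖
        + ‖(X₀ : ℂ) * Complex.exp (I * ((-θ₀ : ℝ) : ℂ)) * (Complex.exp (I * ((θ + θ₀ : ℝ) : ℂ)) - 1)‖ :=
        norm_add_le _ _
    _ = |X - X₀| + X₀ * ‖Complex.exp (I * ((θ + θ₀ : ℝ) : ℂ)) - 1‖ := by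
        rw [norm_mul, norm_mul, norm_mul, hn1, hn2, Complex.norm_real, Complex.norm_real, Real.norm_eq_abs,
          Real.norm_eq_abs, abs_of_pos hX₀0]
        ring
    _ ≤ 108 * Real.pi + 18 * Real.pi :=
        add_le_add hXX ((mul_le_mul_of_nonneg_left hn3 hX₀0.le).trans hX₀θ)
    _ ≤ 400 := by linarith only [Real.pi_lt_d2]

end CharPrimeEdge

end Summit.RiemannHypothesis.RiemannHypothesis.Theorems.LiTheory
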